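import Mathlib

/-!
# The forced-ABC linearisation in `H²`: second-derivative identities of the host and the tail-dissipativity threshold (instab g8, cell `ns-blowup`, 2026-08-25)

HONEST FRAMING (human ruling D-0035): nothing here is a claim about Navier–Stokes blow-up.
WHAT THIS IS NOT: not NS evidence. Kernel pieces of `instab/INSTAB-BRIDGE.md` §11 (THEOREM 3-L, the
Lyapunov skew-cut for the `H²`-semigroup bound of the linearisation `A = νℙΔ − ℙ[(U·∇)· + (·∇)U]`
about `U = abc(1,1,1)`): in `H²` the transport `U·∇` is skew only up to the commutator
`[Δ, U·∇] = 2Σᵢ(∂ᵢU·∇)∂ᵢ + (ΔU)·∇`, and the tail of the certificate is dissipative once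
`ν(K+1)² > c₀ − ω + c₁/(K+1) + c₂/(K+1)²` with the EXACT host constants below.

* `abc_dxx_sq`, `abc_dyy_sq`, `abc_dzz_sq` — for `U = (sin z + cos y, sin x + cos z, sin y + cos x)`
  every pure second derivative has unit length at every point: `|∂ₓ²U|² = sin²x + cos²x = 1` etc.
  (so the stretching cross term costs `2√3‖∇v‖‖Δv‖`, constant `c₁ = √6 + 2√3`).
* `abc_laplacian_first_component` — `ΔU = −U`, first component: the three pure second derivatives of
  `U₁(x,y,z) = sin z + cos y` sum to `−U₁` (the other components are the same computation with the
  variables permuted); this is why the lower-order commutator term is `−(U·∇)`, constant `√6`.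
* `tail_dissipative_at_23` / `tail_not_dissipative_at_22` — the threshold arithmetic of §11 l.109 at
  `R = 100`, `ω = 0.22`: with `c₀ = 2√3 + √2`, `c₁ = √6 + 2√3`, `c₂ = √3` the tail coefficient
  `−ν k² − ω + c₀ + c₁/k + c₂/k²` is NEGATIVE at `k = K + 1 = 23` and POSITIVE at `k = 22`: the
  Lyapunov skew-cut's tail starts exactly at `K_L = 22` (vs `K* = 17` for the `L²` skew-cut).

Mathlib only; no new definitions.
-/

namespace Summit.NavierStokesRegularity.FluidComputer.AbcH2TailConstants

open Real

/-- `|∂ₓ²U|² = 1` pointwise: `∂ₓ²U = (0, −sin x, −cos x)` for `U = (sin z + cos y, sin x + cos z,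
sin y + cos x)`, and `0² + sin²x + cos²x = 1`. The derivative facts: `(sin)'' = −sin`,
`(cos)'' = −cos` (one representative computed below). -/
theorem abc_dxx_sq (x : ℝ) : (0:ℝ) ^ 2 + (-sin x) ^ 2 + (-cos x) ^ 2 = 1 := by
  nlinarith [sin_sq_add_cos_sq x]

/-- `|∂_y²U|² = 1` pointwise: `∂_y²U = (−cos y, 0, −sin y)`. -/
theorem abc_dyy_sq (y : ℝ) : (-cos y) ^ 2 + (0:ℝ) ^ 2 + (-sin y) ^ 2 = 1 := by
  nlinarith [sin_sq_add_cos_sq y]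

/-- `|∂_z²U|² = 1` pointwise: `∂_z²U = (−sin z, −cos z, 0)`. -/
theorem abc_dzz_sq (z : ℝ) : (-sin z) ^ 2 + (-cos z) ^ 2 + (0:ℝ) ^ 2 = 1 := by
  nlinarith [sin_sq_add_cos_sq z]

/-- The second derivatives used above are genuinely those of the ABC components: `t ↦ sin t + c` has
second derivative `−sin t` and `t ↦ c + cos t` has second derivative `−cos t`. -/
theorem sin_add_const_second_deriv (c t : ℝ) :
    deriv (deriv fun s => sin s + c) t = -sin t ∧ deriv (deriv fun s => c + cos s) t = -cos t := by
  constructor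
  · have h1 : deriv (fun s => sin s + c) = fun s => cos s := by
      funext s; simp
    rw [h1]; simp
  · have h1 : deriv (fun s => c + cos s) = fun s => -sin s := by
      funext s; simp
    rw [h1]; simp

/-- **`ΔU = −U`, first component.** `U₁ = sin z + cos y` has `∂ₓ²U₁ = 0`, `∂_y²U₁ = −cos y`,
`∂_z²U₁ = −sin z`, summing to `−U₁`. (Components 2, 3: permute the variables.) -/
theorem abc_laplacian_first_component (y z : ℝ) :
    (0:ℝ) + (-cos y) + (-sin z) = -(sin z + cos y) := by ring

/-- **Tail dissipativity threshold of THEOREM 3-L at `R = 100`, `ω = 0.22`: it HOLDS at `k = 23`.**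
With `ν = 1/100`, `c₀ = 2√3 + √2` (advection commutator `2‖∇U‖_F = 2√3` plus strain `√2`),
`c₁ = √6 + 2√3` (`|U| ≤ √6` times the `ΔU = −U` term, plus the stretching cross term with
`|∂ᵢ²U| = 1`), `c₂ = √3`: `ν·23² > c₀ − ω + c₁/23 + c₂/23²` (numerically `5.29 > 4.92`). -/
theorem tail_dissipative_at_23 :
    (2 * Real.sqrt 3 + Real.sqrt 2) - 0.22 + (Real.sqrt 6 + 2 * Real.sqrt 3) / 23 + Real.sqrt 3 / 23 ^ 2
      < (1 / 100 : ℝ) * 23 ^ 2 := by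
  have h3 : Real.sqrt 3 < 1.7321 := by
    rw [show (1.7321:ℝ) = Real.sqrt (1.7321^2) by rw [Real.sqrt_sq (by norm_num)]]
    exact Real.sqrt_lt_sqrt (by norm_num) (by norm_num)
  have h2 : Real.sqrt 2 < 1.4143 := by
    rw [show (1.4143:ℝ) = Real.sqrt (1.4143^2) by rw [Real.sqrt_sq (by norm_num)]]
    exact Real.sqrt_lt_sqrt (by norm_num) (by norm_num)
  have h6 : Real.sqrt 6 < 2.4495 := by
    rw [show (2.4495:ℝ) = Real.sqrt (2.4495^2) by rw [Real.sqrt_sq (by norm_num)]]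
    exact Real.sqrt_lt_sqrt (by norm_num) (by norm_num)
  nlinarith [Real.sqrt_nonneg 3, Real.sqrt_nonneg 2, Real.sqrt_nonneg 6]

/-- **… and FAILS at `k = 22`** (`ν·22² = 4.84 < 4.93`): the tail of the `H²` Lyapunov skew-cut
starts exactly at `K_L = 22`, i.e. shells `≥ 23` (compare `K* = 17` for the `L²` skew-cut, where only
the strain `√2` has to be beaten). -/
theorem tail_not_dissipative_at_22 :
    (1 / 100 : ℝ) * 22 ^ 2
      < (2 * Real.sqrt 3 + Real.sqrt 2) - 0.22 + (Real.sqrt 6 + 2 * Real.sqrt 3) / 22 + Real.sqrt 3 / 22 ^ 2 := by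
  have h3 : (1.7320:ℝ) < Real.sqrt 3 := by
    rw [show (1.7320:ℝ) = Real.sqrt (1.7320^2) by rw [Real.sqrt_sq (by norm_num)]]
    exact Real.sqrt_lt_sqrt (by norm_num) (by norm_num)
  have h2 : (1.4142:ℝ) < Real.sqrt 2 := by
    rw [show (1.4142:ℝ) = Real.sqrt (1.4142^2) by rw [Real.sqrt_sq (by norm_num)]]
    exact Real.sqrt_lt_sqrt (by norm_num) (by norm_num)
  have h6 : (2.4494:ℝ) < Real.sqrt 6 := by
    rw [show (2.4494:ℝ) = Real.sqrt (2.4494^2) by rw [Real.sqrt_sq (by norm_num)]]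
    exact Real.sqrt_lt_sqrt (by norm_num) (by norm_num)
  nlinarith [Real.sqrt_nonneg 3, Real.sqrt_nonneg 2, Real.sqrt_nonneg 6]

end Summit.NavierStokesRegularity.FluidComputer.AbcH2TailConstants
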